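import Summits.CriticalPhenomena.SAWScalingLimit.Theses.SAWDefectDecoherence
import Literature.Probability.RandomPlanarGeometry.HexSAWLowerBound

/-!
# Sketch (crux-ideate round 2, ideator 6 / gen 2) — crux `MassRatio` (stmt-CriticalPhenomena-8550)

Two idea cards, first lemmas only (no skeleton at this stage):

* Card `tip-rate-mean-value`: the σ = 0 mass field `u(z) = Z_Λ(a → z)` obeys the EXACT one-step
  recursion `u = 1_a + x·A u − x·D` (`A` = the kagome-type "share a vertex of Λ" operator on
  mid-edges, `D` = blocked mass); tested against a finitely supported `h` this is the identity
  `Σ u·(h − xAh) = −x Σ D·h` (`MeanValueIdentity`), and against a Perron vector of `A` on a region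
  `G` it is a MEAN-VALUE PROPERTY of `u` whose only error term is the spatial fluctuation of the
  tip self-contact rate `r = xD/u` around its equilibrium value `4x_c − 1` (forced by criticality).
* Card `octave-logconvexity-bootstrap`: a SHAPE statement (the doubling ratio `B_{2T}/B_T` of
  Duminil-Copin–Smirnov's bridge masses is nondecreasing in `T`) plus ONE finite certificate
  `B_{2T₀}/B_{T₀} ≥ b₀` gives the power lower bound `B_T ≥ C T^{log₂ b₀}` for all `T`
  (`DyadicBootstrap`, provable now); the bulk analogue with a nonincreasing doubling ratio of the
  mid-level mass `M_T` gives the upper certification; together `StripMassRatio`.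
-/

namespace Summit.CriticalPhenomena.SAWScalingLimit.Cruxes.MassRatio.IdeatorSixG2

open Literature.Probability.LatticeModels Literature.Probability.RandomPlanarGeometry
open Literature.Probability.RandomPlanarGeometry.SAW
open Summit.CriticalPhenomena.SAWScalingLimit.Theses.SAWDefectDecoherence

noncomputable section
open scoped Classical

/-! ## Card A — tip-rate mean value -/

/-- `σ = 0` mass `u(z) = Z_Λ(a → z) = Σ_{γ ⊂ Λ : a → z} x^{ℓ(γ)}` as a real sum
(`= ‖F_{x,0}(z)‖`, `hexParafermionicObservable_zero_spin`). -/
def Zr (Λ : Finset HexVertex) (a : Sym2 HexVertex) (x : ℝ) (z : Sym2 HexVertex) : ℝ :=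
  ∑ γ : HexMidEdgeSAW Λ a z, x ^ γ.length

/-- BLOCKED mass: walks `a → z'` whose visited vertices contain `w` (so they cannot be extended
through `w`; includes the walks that arrived at `z'` through `w`). -/
def blocked (Λ : Finset HexVertex) (a : Sym2 HexVertex) (x : ℝ) (z' : Sym2 HexVertex)
    (w : HexVertex) : ℝ :=
  ∑ γ : HexMidEdgeSAW Λ a z', if w ∈ γ.verts then x ^ γ.length else 0

/-- The other mid-edges at the vertex `w`: `{ {w,y} : y ∼ w, {w,y} ≠ z }`. -/
def starOthers (w : HexVertex) (z : Sym2 HexVertex) : Set (Sym2 HexVertex) :=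
  {z' | ∃ y : HexVertex, hexGraph.Adj w y ∧ z' = s(w, y) ∧ z' ≠ z}

/-- The kagome-type operator "through vertices of `Λ`":
`(A h)(z) = Σ_{w ∈ z ∩ Λ} Σ_{z' ∈ star(w) ∖ z} h(z')` (symmetric on the mid-edges of `Λ`; every
interior mid-edge has 4 neighbours, so `ρ(A_G) ↑ 4` on large regions). -/
def starOp (Λ : Finset HexVertex) (h : Sym2 HexVertex → ℝ) (z : Sym2 HexVertex) : ℝ :=
  ∑ᶠ w ∈ {w : HexVertex | w ∈ z ∧ w ∈ Λ}, ∑ᶠ z' ∈ starOthers w z, h z'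

/-- Total blocked mass feeding `z`: `D(z) = Σ_{w ∈ z ∩ Λ} Σ_{z' ∈ star(w) ∖ z} blocked(z', w)`. -/
def blockedAt (Λ : Finset HexVertex) (a : Sym2 HexVertex) (x : ℝ) (z : Sym2 HexVertex) : ℝ :=
  ∑ᶠ w ∈ {w : HexVertex | w ∈ z ∧ w ∈ Λ}, ∑ᶠ z' ∈ starOthers w z, blocked Λ a x z' w

/-- FIRST LEMMA (provable now, size M: the last-step bijection
`γ ↦ (w = last vertex, z' = previous mid-edge, prefix)`): for a boundary root `a`, every fugacity
`x` and every mid-edge `z` of `Λ`,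
`u(z) = 1_{z=a} + x·[(A u)(z) − D(z)]`. Verified by exact enumeration to `1e-12`
(toy/tiprate.py, brick domains up to 60 vertices). -/
def OneStepRecursion : Prop :=
  ∀ (Λ : Finset HexVertex) (a : Sym2 HexVertex) (x : ℝ), a ∈ hexDomainBoundary Λ →
    ∀ z ∈ hexDomainMidEdges Λ,
      Zr Λ a x z = (if z = a then 1 else 0) + x * (starOp Λ (Zr Λ a x) z - blockedAt Λ a x z)

/-- MEAN-VALUE IDENTITY (provable now from `OneStepRecursion` by finite summation by parts, `A`
symmetric; size S): for every test function `h` supported on the mid-edges of `Λ` with `h(a) = 0`,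
`Σ_z u(z)·(h(z) − x·(A h)(z)) = −x·Σ_z D(z)·h(z)`.  With `h = φ_G` a Perron vector of `A`
restricted to a region `G ∌ a` (`A_G φ = ρ_G φ`, `φ ≥ 0`, extended by `0`) this reads
`x·RIM_φ(G) = x·Σ_G D φ − (xρ_G − 1)·Σ_G u φ`, i.e.
`RIM_φ = (4 − ρ_G)·Σ_G uφ + x⁻¹Σ_G (r − r_∞) u φ` with `r = xD/u`, `r_∞ = 4x − 1`:
a discrete mean-value property of `u` whose only error is the tip-rate fluctuation
(verified: toy/meanvalue.py, |FLUC|/MAIN ≤ 0.09 on a 60-vertex brick domain). -/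
def MeanValueIdentity : Prop :=
  ∀ (Λ : Finset HexVertex) (a : Sym2 HexVertex) (x : ℝ) (h : Sym2 HexVertex → ℝ),
    a ∈ hexDomainBoundary Λ → h a = 0 → (∀ z, z ∉ hexDomainMidEdges Λ → h z = 0) →
      ∑ᶠ z ∈ hexDomainMidEdges Λ, Zr Λ a x z * (h z - x * starOp Λ h z)
        = -x * ∑ᶠ z ∈ hexDomainMidEdges Λ, blockedAt Λ a x z * h z

/-- The one-sided, FREE consequence (provable now from `OneStepRecursion`, pointwise algebra):
an UPPER bound on the tip rate at `z`, `x·D(z) ≤ (4x − 1 + η)·u(z)`, is EQUIVALENT to the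
super-mean-value inequality `u(z) ≥ (x/(4x + η))·(A u)(z)` (so `u(z) ≥ (A u)(z)/4` at `η = 0`:
`u` dominates the average of its 4 kagome neighbours).  This is the dictionary
"Harnack-type comparability of σ = 0 masses ⟺ homogeneity of ONE local tip statistic". -/
def SuperMeanValueOfRate : Prop :=
  ∀ (Λ : Finset HexVertex) (a : Sym2 HexVertex) (x η : ℝ), 0 < x → 0 ≤ η → a ∈ hexDomainBoundary Λ →
    ∀ z ∈ hexDomainMidEdges Λ, z ≠ a →
      x * blockedAt Λ a x z ≤ (4 * x - 1 + η) * Zr Λ a x z →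
        x / (4 * x + η) * starOp Λ (Zr Λ a x) z ≤ Zr Λ a x z

/-- TIP-RATE HOMOGENEITY at precision `ε` on a set of mid-edges `G` (the card's conditional input,
Perron-averaged form is what the line consumes; pointwise form stated for readability):
`|x·D(z) − (4x_c − 1)·u(z)| ≤ ε·u(z)` on `G`. Predicted: `ε ≍ δ^{Δ}` at macroscopic depth with
`Δ = x₃ − x₁ = 3/2` (3-leg content of a tip contact) or `11/12` (CGJPRS correction-to-scaling);
`Δ = 2` would give macroscopic interior + boundary Harnack at exponent 0. -/
def TipRateHomogeneity (Λ : Finset HexVertex) (a : Sym2 HexVertex) (ε : ℝ)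
    (G : Set (Sym2 HexVertex)) : Prop :=
  ∀ z ∈ G, |hexCriticalFugacity * blockedAt Λ a hexCriticalFugacity z
      - (4 * hexCriticalFugacity - 1) * Zr Λ a hexCriticalFugacity z|
    ≤ ε * Zr Λ a hexCriticalFugacity z

/-! ## Card B — octave log-convexity bootstrap (shape + one certificate ⟹ exponent) -/

open Literature.Probability.RandomPlanarGeometry.SAW.HV (stripBlim stripV midWalks finalDart mwLen lev)

/-- SHAPE INPUT 1: the doubling ratio `b(T) = B_{2T}/B_T` of DCS's bridge masses `B_T(x_c)`
(`HV.stripBlim`) is nondecreasing in `T` (⟺ `log B` is convex along dyadic scales; numerically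
BGJ 2011 (arXiv:1110.1141 §2) report the local exponent `gradB(T)` monotone in `T`, linear in
`T^{-0.85}`, for `T ≤ 10`). A qualitative statement: no exponent in it. -/
def DoublingMonotone : Prop :=
  ∀ T : ℕ, 1 ≤ T → stripBlim (2 * T) * stripBlim (T + 1) ≤ stripBlim (2 * (T + 1)) * stripBlim T

/-- `B_{T+1} ≤ B_T` (DCS §3: `A_T` increases and `c_α A_T + B_T = 1` once `E_T ≡ 0`,
BBDDG Prop. 4; used only to interpolate between dyadic widths). -/
def BAntitone : Prop := ∀ T : ℕ, 1 ≤ T → stripBlim (T + 1) ≤ stripBlim T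

/-- FIRST LEMMA of card B (provable now, size S, induction on `k`): under `DoublingMonotone`,
`B_{T₀ 2^k} ≥ B_{T₀} · b(T₀)^k`. -/
def DyadicBootstrap : Prop :=
  ∀ T₀ : ℕ, 1 ≤ T₀ → DoublingMonotone → (∀ T : ℕ, 1 ≤ T → 0 < stripBlim T) →
    ∀ k : ℕ, stripBlim T₀ * (stripBlim (2 * T₀) / stripBlim T₀) ^ k ≤ stripBlim (T₀ * 2 ^ k)

/-- The finite CERTIFICATE at width `T₀` (a transfer-matrix computation with interval arithmetic;
BGJ computed `B_T(x_c)` for `T ≤ 10` on the honeycomb lattice): `b₀ ≤ B_{2T₀}/B_{T₀}`. -/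
def DoublingCertificate (T₀ : ℕ) (b₀ : ℝ) : Prop := b₀ ≤ stripBlim (2 * T₀) / stripBlim T₀

/-- Power lower bound on bridge masses: `B_T ≥ C·T^{-β}` for all `T ≥ 1`. The boundary
certification of the necessity ledger needs `β ≤ 0.48` at arc level (truth `1/4`; DCS: `β = 1`). -/
def BridgePowerLower (β : ℝ) : Prop :=
  ∃ C : ℝ, 0 < C ∧ ∀ T : ℕ, 1 ≤ T → C * (T : ℝ) ^ (-β) ≤ stripBlim T

/-- Card B, boundary half: shape + antitone interpolation + one certificate ⟹ power law with the
CERTIFIED exponent `β₀ = −log₂ b₀` (provable now from `DyadicBootstrap`, size M). -/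
def BoundaryHalf : Prop :=
  ∀ (T₀ : ℕ) (b₀ : ℝ), 1 ≤ T₀ → 0 < b₀ → b₀ ≤ 1 → DoublingMonotone → BAntitone →
    (∀ T : ℕ, 1 ≤ T → 0 < stripBlim T) → DoublingCertificate T₀ b₀ →
      BridgePowerLower (-Real.logb 2 b₀)

/-- Mid-level BULK mass of the strip `S_{T,L}`: walks from `a` ending at an INTERIOR mid-edge whose
final vertex sits on level `T` (the middle of the strip); `M_T := sup_L M_{T,L}(x_c)` (finite: the
strip is subcritical along its length). Predicted `M_T ≍ T^{1 − h_b − x₁} = T^{13/48}`. -/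
def stripM (T L : ℕ) (x : ℝ) : ℝ :=
  ∑ P ∈ (midWalks (stripV T L)).filter (fun P =>
      (finalDart P).1 ∈ stripV T L ∧ (finalDart P).2 ∈ stripV T L ∧ lev (finalDart P).2 = T),
    x ^ mwLen P

/-- `M_T(x_c) := sup_L M_{T,L}(x_c)`. -/
def stripMlim (T : ℕ) : ℝ := ⨆ L : ℕ, stripM T L hexCriticalFugacity

/-- SHAPE INPUT 2 (bulk): the doubling ratio `M_{2T}/M_T` is nonincreasing in `T`. -/
def BulkDoublingAntitone : Prop :=
  ∀ T : ℕ, 1 ≤ T → stripMlim (2 * (T + 1)) * stripMlim T ≤ stripMlim (2 * T) * stripMlim (T + 1)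

/-- The canonical strip form of the crux's exponent core: `M_T ≤ C·T^{c}·B_T`
(truth `c = h_b − x₁ = 25/48`; the crux's cut is `3/4`; SRW value `1`). -/
def StripMassRatio (c : ℝ) : Prop :=
  ∃ C : ℝ, ∀ T : ℕ, 1 ≤ T → stripMlim T ≤ C * (T : ℝ) ^ c * stripBlim T

/-- Card B, core payoff (provable now modulo its named inputs, size M): two shape statements, the
interpolating monotonicities, and ONE certificate at width `T₀` with
`log₂(m₀/b₀) ≤ c₀` give `StripMassRatio c₀` — the two exponent certifications of the necessity
ledger replaced by qualitative monotonicity + a finite computation. -/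
def CoreBootstrap : Prop :=
  ∀ (T₀ : ℕ) (b₀ m₀ c₀ : ℝ), 1 ≤ T₀ → 0 < b₀ → 0 < m₀ →
    DoublingMonotone → BAntitone → BulkDoublingAntitone →
    (∀ T : ℕ, 1 ≤ T → 0 < stripBlim T) → (∀ T : ℕ, 1 ≤ T → stripMlim T ≤ stripMlim (T + 1)) →
    DoublingCertificate T₀ b₀ → stripMlim (2 * T₀) / stripMlim T₀ ≤ m₀ →
    Real.logb 2 (m₀ / b₀) ≤ c₀ → StripMassRatio c₀


/-! ## Proved now: the dyadic bootstrap of card B -/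

/-- Monotonicity of the doubling ratio propagates from `T₀` to every `T ≥ T₀`. -/
theorem doubling_ratio_mono (hmono : DoublingMonotone) (hpos : ∀ T : ℕ, 1 ≤ T → 0 < stripBlim T)
    {T₀ : ℕ} (hT₀ : 1 ≤ T₀) : ∀ T : ℕ, T₀ ≤ T →
      stripBlim (2 * T₀) / stripBlim T₀ ≤ stripBlim (2 * T) / stripBlim T := by
  intro T hT
  induction T, hT using Nat.le_induction with
  | base => exact le_rfl
  | succ T hT ih =>
    refine ih.trans ?_
    have h1 : 0 < stripBlim T := hpos T (hT₀.trans hT)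
    have h2 : 0 < stripBlim (T + 1) := hpos (T + 1) (by omega)
    rw [div_le_div_iff₀ h1 h2]
    exact hmono T (hT₀.trans hT)

/-- **`DyadicBootstrap` holds** (card B's first lemma): `B_{T₀} · b(T₀)^k ≤ B_{T₀ 2^k}`. -/
theorem dyadicBootstrap : DyadicBootstrap := by
  intro T₀ hT₀ hmono hpos k
  induction k with
  | zero => simp
  | succ k ih =>
    have hT : T₀ ≤ T₀ * 2 ^ k := Nat.le_mul_of_pos_right _ (Nat.pos_of_ne_zero (by positivity))
    have hTpos : 0 < stripBlim (T₀ * 2 ^ k) := hpos _ (hT₀.trans hT)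
    have hb : 0 ≤ stripBlim (2 * T₀) / stripBlim T₀ :=
      div_nonneg (hpos _ (by omega)).le (hpos _ hT₀).le
    have hr := doubling_ratio_mono hmono hpos hT₀ (T₀ * 2 ^ k) hT
    -- B(T₀) b^{k+1} = (B(T₀) b^k) · b ≤ B(T₀ 2^k) · (B(2·T₀2^k)/B(T₀2^k)) = B(T₀ 2^{k+1})
    calc stripBlim T₀ * (stripBlim (2 * T₀) / stripBlim T₀) ^ (k + 1)
        = stripBlim T₀ * (stripBlim (2 * T₀) / stripBlim T₀) ^ k
            * (stripBlim (2 * T₀) / stripBlim T₀) := by ring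
      _ ≤ stripBlim (T₀ * 2 ^ k) * (stripBlim (2 * (T₀ * 2 ^ k)) / stripBlim (T₀ * 2 ^ k)) :=
            mul_le_mul ih hr hb hTpos.le
      _ = stripBlim (T₀ * 2 ^ (k + 1)) := by
            rw [mul_div_cancel₀ _ hTpos.ne']
            ring_nf

/-! ## Proved now: card A's free dictionary half, from the recursion -/

/-- **`OneStepRecursion → SuperMeanValueOfRate`**: an upper bound on the tip rate at `z` gives the
super-mean-value inequality at `z` (pure algebra on the recursion). -/
theorem superMeanValue_of_recursion (hrec : OneStepRecursion) : SuperMeanValueOfRate := by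
  intro Λ a x η hx hη ha z hz hza hrate
  have h := hrec Λ a x ha z hz
  rw [if_neg hza, zero_add] at h
  -- `x·(A u)(z) = u(z) + x·D(z) ≤ (4x + η)·u(z)`
  have hAu : x * starOp Λ (Zr Λ a x) z ≤ (4 * x + η) * Zr Λ a x z := by nlinarith [h, hrate]
  have hpos : 0 < 4 * x + η := by linarith
  rw [div_mul_eq_mul_div, div_le_iff₀ hpos]
  linarith [hAu]

end

end Summit.CriticalPhenomena.SAWScalingLimit.Cruxes.MassRatio.IdeatorSixG2
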